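import Mathlib.FieldTheory.Galois.Basic
import Mathlib.GroupTheory.SpecificGroups.Cyclic.Basic
import Mathlib.RingTheory.RootsOfUnity.Basic
import Literature.FieldTheory.Kummer.KummerFiniteRank
import HarnessLib

/-!
# Radicals of the base inside a Kummer extension

Let `E ⊆ Ω` be a subfield containing all roots of unity of `Ω` and a primitive `N`-th root of
unity, and let `y₁, …, y_k ∈ Ωˣ` with `yᵢᴺ ∈ E`. Then every `z ∈ E(y₁, …, y_k)` some power of which
lies in `E` is a monomial: `z = e ∏ yᵢ^{vᵢ}` with `e ∈ E` (Lang, *Algebra* VI §8, Thm 8.2 — the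
Kummer pairing is perfect: the radicals of `E` inside `E(Δ^{1/N})` are `Eˣ Δ^{1/N}`; Bays–Zilber
2011, Lemma 5.1). We prove it without computing degrees, by induction on `k`: the step is the
cyclic case `E' ⊆ E'(y)`, where `Gal(E'(y)/E')` is cyclic (it embeds into `Ωˣ` by
`σ ↦ σ(y)/y`), its image is exactly `μ_d(Ω)` (`d` the order of the group), so the root of unity
`σ₀(z)/z` (`σ₀` a generator) equals `σ₁(y)/y = (σ₀(y)/y)ʲ` for some `σ₁ = σ₀ʲ`, whence `z y⁻ʲ` is
fixed by the Galois group.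

* `Literature.FieldTheory.Kummer.KummerRadicals.exists_eq_mul_pow_of_pow_mem` — the cyclic step;
* `Literature.FieldTheory.Kummer.KummerRadicals.exists_eq_mul_prod_pow` — `k` generators.

## References

* S. Lang, *Algebra*, 3rd ed., GTM 211, Springer 2002, VI §8, Thm 8.2.
* M. Bays, B. Zilber, *Covers of multiplicative groups of algebraically closed fields of arbitrary
  characteristic*, Bull. LMS 43 (2011), Lemma 5.1.
-/

noncomputable section

open IntermediateField

namespace Literature.FieldTheory.Kummer

namespace KummerRadicals

universe u

variable {Ω : Type u} [Field Ω]

/-- Powers of an automorphism applied to an element it rescales by a fixed scalar: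
if `σ θ = θ` and `σ x = θ x` then `σⁱ x = θⁱ x`. [folklore] -/
theorem algEquiv_pow_apply_of_apply_eq_mul {K F : Type*} [Field K] [Field F] [Algebra K F]
    (σ : F ≃ₐ[K] F) {x θ : F} (hθ : σ θ = θ) (hx : σ x = θ * x) (i : ℕ) :
    (σ ^ i) x = θ ^ i * x := by
  induction i with
  | zero => simp
  | succ i ih => rw [pow_succ', AlgEquiv.mul_apply, ih, map_mul, map_pow, hθ, hx, pow_succ, mul_assoc]

/-- An element fixed by `σ` is fixed by all powers of `σ`. [folklore] -/
theorem algEquiv_pow_apply_of_apply_eq {K F : Type*} [Field K] [Field F] [Algebra K F]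
    (σ : F ≃ₐ[K] F) {x : F} (hx : σ x = x) (i : ℕ) : (σ ^ i) x = x := by
  have := algEquiv_pow_apply_of_apply_eq_mul σ (θ := 1) (map_one σ) (by rw [one_mul]; exact hx) i
  rwa [one_pow, one_mul] at this

/-- **The cyclic step.** Let `E ⊆ Ω` be a subfield containing every root of unity of `Ω` and a
primitive `N`-th root of unity, `y ∈ Ωˣ` with `yᴺ ∈ E`, and `z ∈ E(y)` with `z^{N'} ∈ E`
(`N' ≥ 1`). Then `z = e yʲ` for some `e ∈ E`, `j ∈ ℕ`. [cite: Lang2002, VI §8 Thm 8.2] -/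
theorem exists_eq_mul_pow_of_pow_mem (E : Subfield Ω)
    (hμ : ∀ m : ℕ, 0 < m → ∀ θ : Ω, θ ^ m = 1 → θ ∈ E)
    {N : ℕ} (hN : 0 < N) {ζ : Ω} (hζ : IsPrimitiveRoot ζ N) (hζE : ζ ∈ E)
    {y : Ω} (hy0 : y ≠ 0) (hyN : y ^ N ∈ E)
    {z : Ω} (hz : z ∈ Subfield.closure ((E : Set Ω) ∪ {y})) {N' : ℕ} (hN' : 0 < N')
    (hzN' : z ^ N' ∈ E) :
    ∃ e ∈ E, ∃ j : ℕ, z = e * y ^ j := by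
  classical
  -- trivial case `z = 0`
  by_cases hz0 : z = 0
  · exact ⟨0, E.zero_mem, 0, by rw [hz0, zero_mul]⟩
  haveI : NeZero N := ⟨hN.ne'⟩
  -- the Kummer field `KF = E(y)` of rank one
  let y' : Fin 1 → Ω := fun _ => y
  let c : Fin 1 → E := fun _ => ⟨y ^ N, hyN⟩
  have hc : ∀ i, c i ≠ 0 := fun i h => pow_ne_zero N hy0 (congrArg Subtype.val h)
  have hy' : ∀ i, y' i ^ N = algebraMap E Ω (c i) := fun i => rfl
  have hζ' : IsPrimitiveRoot (⟨ζ, hζE⟩ : E) N :=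
    IsPrimitiveRoot.of_map_of_injective (f := algebraMap E Ω) (by exact hζ) (algebraMap E Ω).injective
  set KF : IntermediateField E Ω := kummerField E y' with hKF
  haveI : IsGalois E KF := isGalois_kummerField hζ' y' c hc hy'
  haveI : Finite (Set.range y') := (Set.finite_range y').to_subtype
  haveI : FiniteDimensional E KF := by
    refine IntermediateField.finiteDimensional_adjoin fun x hx => ?_
    obtain ⟨i, rfl⟩ := hx
    exact IsIntegral.of_pow hN (by rw [hy' i]; exact isIntegral_algebraMap)
  -- membership of `y` and `z` in `KF`
  have hyKF : y ∈ KF := IntermediateField.subset_adjoin E _ ⟨0, rfl⟩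
  have hEKF : ∀ x ∈ E, x ∈ KF := fun x hx => KF.algebraMap_mem ⟨x, hx⟩
  have hzKF : z ∈ KF := by
    refine (Subfield.closure_le (t := KF.toSubfield)).2 ?_ hz
    rintro x (hx | hx)
    · exact hEKF x hx
    · rw [Set.mem_singleton_iff] at hx
      rw [hx]; exact hyKF
  set yK : KF := ⟨y, hyKF⟩ with hyK
  set zK : KF := ⟨z, hzKF⟩ with hzK
  have hyK0 : yK ≠ 0 := fun h => hy0 (congrArg Subtype.val h)
  have hzK0 : zK ≠ 0 := fun h => hz0 (congrArg Subtype.val h)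
  -- the characters `σ ↦ σ(x)/x` for `x = y, z`: values are roots of unity, hence in `E`
  have hchar : ∀ (x : KF) (P : ℕ), 0 < P → (x : Ω) ^ P ∈ E → x ≠ 0 →
      ∀ σ : KF ≃ₐ[E] KF, ∃ θ : Ω, θ ∈ E ∧ θ ≠ 0 ∧ (σ x : Ω) = θ * x := by
    intro x P hP hxP hx0 σ
    have hx0' : (x : Ω) ≠ 0 := fun h => hx0 (Subtype.ext h)
    refine ⟨(σ x : Ω) * (x : Ω)⁻¹, ?_, ?_, by rw [inv_mul_cancel_right₀ hx0']⟩
    · apply hμ P hP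
      have h1 : x ^ P = algebraMap E KF ⟨(x : Ω) ^ P, hxP⟩ := Subtype.ext rfl
      have h2 : ((σ x : KF) : Ω) ^ P = (x : Ω) ^ P := by
        rw [← SubmonoidClass.coe_pow, ← map_pow, h1, AlgEquiv.commutes]
        rfl
      rw [mul_pow, h2, inv_pow, mul_inv_cancel₀ (pow_ne_zero _ hx0')]
    · have : (σ x : Ω) ≠ 0 := by
        intro h
        apply hx0
        have h3 : σ x = 0 := Subtype.ext h
        simpa using congrArg σ.symm h3
      exact mul_ne_zero this (inv_ne_zero hx0')
  -- the homomorphisms `φ_x : Gal → Ωˣ`, `σ ↦ σ(x)/x`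
  have hhom : ∀ (x : KF) (P : ℕ), 0 < P → (x : Ω) ^ P ∈ E → x ≠ 0 →
      ∃ φ : (KF ≃ₐ[E] KF) →* Ωˣ, ∀ σ, ((φ σ : Ωˣ) : Ω) = (σ x : Ω) * (x : Ω)⁻¹ := by
    intro x P hP hxP hx0
    have hx0' : (x : Ω) ≠ 0 := fun h => hx0 (Subtype.ext h)
    have hval : ∀ σ : KF ≃ₐ[E] KF, (σ x : Ω) * (x : Ω)⁻¹ ≠ 0 := fun σ => by
      obtain ⟨θ, -, hθ0, hθ⟩ := hchar x P hP hxP hx0 σ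
      rw [hθ, mul_inv_cancel_right₀ hx0']
      exact hθ0
    refine ⟨MonoidHom.mk' (fun σ => Units.mk0 _ (hval σ)) ?_, fun σ => rfl⟩
    intro σ τ
    apply Units.ext
    change ((σ * τ) x : Ω) * (x : Ω)⁻¹ = (σ x : Ω) * (x : Ω)⁻¹ * ((τ x : Ω) * (x : Ω)⁻¹)
    obtain ⟨θ, hθE, hθ0, hθ⟩ := hchar x P hP hxP hx0 τ
    have hτx : τ x = algebraMap E KF ⟨θ, hθE⟩ * x := Subtype.ext hθ
    have hL : ((σ * τ) x : Ω) = θ * (σ x : Ω) := by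
      rw [AlgEquiv.mul_apply, hτx, map_mul, AlgEquiv.commutes]; rfl
    rw [hL, hθ]
    field_simp
  obtain ⟨φy, hφy⟩ := hhom yK N hN hyN hyK0
  obtain ⟨φz, hφz⟩ := hhom zK N' hN' hzN' hzK0
  -- `φy` is injective: an automorphism is determined by its value on the generator `y`
  have hyK0' : (yK : Ω) ≠ 0 := hy0
  have hinj : Function.Injective φy := by
    intro σ τ h
    have h1 : (σ yK : Ω) = (τ yK : Ω) := by
      have h2 : ((φy σ : Ωˣ) : Ω) = (φy τ : Ω) := by rw [h]
      rw [hφy, hφy] at h2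
      have h3 := congrArg (· * (yK : Ω)) h2
      rwa [inv_mul_cancel_right₀ hyK0', inv_mul_cancel_right₀ hyK0'] at h3
    have hgen : σ yK = τ yK := Subtype.ext h1
    have : (σ : KF →ₐ[E] KF) = τ := by
      refine IntermediateField.adjoin_algHom_ext E ?_
      rintro _ ⟨i, rfl⟩
      exact hgen
    exact AlgEquiv.coe_toAlgHom_injective this
  -- hence the Galois group is cyclic, with generator `σ₀`
  haveI : IsCyclic (KF ≃ₐ[E] KF) :=
    isCyclic_of_injective_ringHom ((Units.coeHom Ω).comp φy) (Units.val_injective.comp hinj)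
  obtain ⟨σ₀, hσ₀⟩ := IsCyclic.exists_generator (α := KF ≃ₐ[E] KF)
  set d : ℕ := Nat.card (KF ≃ₐ[E] KF) with hd
  have hdpos : 0 < d := Nat.card_pos
  haveI : NeZero d := ⟨hdpos.ne'⟩
  -- the image of `φy` is `μ_d(Ω)`
  have hrange_le : φy.range ≤ rootsOfUnity d Ω := by
    rintro _ ⟨σ, rfl⟩
    rw [mem_rootsOfUnity, ← map_pow, hd, pow_card_eq_one', map_one]
  have hrange : φy.range = rootsOfUnity d Ω := by
    apply Subgroup.eq_of_le_of_card_ge hrange_le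
    calc Nat.card (rootsOfUnity d Ω) ≤ d := card_rootsOfUnity Ω d
      _ = Nat.card φy.range := by
          rw [hd]; exact Nat.card_congr (MonoidHom.ofInjective hinj).toEquiv
  -- `φz σ₀ ∈ μ_d(Ω) = range φy`, so `φz σ₀ = φy (σ₀ ^ j)`
  have hθd : φz σ₀ ∈ rootsOfUnity d Ω := by
    rw [mem_rootsOfUnity, ← map_pow, hd, pow_card_eq_one', map_one]
  rw [← hrange] at hθd
  obtain ⟨σ₁, hσ₁⟩ := hθd
  obtain ⟨j, hj⟩ := (Submonoid.mem_powers_iff _ _).1 (mem_powers_iff_mem_zpowers.2 (hσ₀ σ₁))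
  have hθη : φz σ₀ = φy σ₀ ^ j := by rw [← map_pow, hj, hσ₁]
  -- in `Ω`: `σ₀ z = η ^ j z`, `σ₀ y = η y` with `η = σ₀(y)/y ∈ E`
  set η : Ω := (φy σ₀ : Ω) with hηdef
  have hηE : η ∈ E := by
    obtain ⟨θ, hθE, -, hθ⟩ := hchar yK N hN hyN hyK0 σ₀
    have : η = θ := by
      rw [hηdef, hφy, hθ, mul_inv_cancel_right₀ hy0]
    rw [this]; exact hθE
  have hσ₀y : (σ₀ yK : Ω) = η * y := by
    rw [hηdef, hφy, inv_mul_cancel_right₀ hy0]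
  have hσ₀z : (σ₀ zK : Ω) = η ^ j * z := by
    have : (φz σ₀ : Ω) = η ^ j := by
      rw [hθη, Units.val_pow_eq_pow_val]
    rw [← this, hφz, inv_mul_cancel_right₀ hz0]
  -- `u = z / y ^ j` is fixed by `σ₀`, hence by the whole (cyclic) Galois group
  set u : KF := zK * (yK ^ j)⁻¹ with hu
  have hσ₀η : σ₀ (algebraMap E KF ⟨η, hηE⟩) = algebraMap E KF ⟨η, hηE⟩ := AlgEquiv.commutes σ₀ _
  have hσ₀yK : σ₀ yK = algebraMap E KF ⟨η, hηE⟩ * yK := Subtype.ext hσ₀y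
  have hσ₀zK : σ₀ zK = (algebraMap E KF ⟨η, hηE⟩) ^ j * zK := Subtype.ext (by
    rw [MulMemClass.coe_mul, SubmonoidClass.coe_pow, hσ₀z]; rfl)
  have hη0 : (algebraMap E KF ⟨η, hηE⟩) ≠ 0 := by
    rw [map_ne_zero_iff _ (algebraMap E KF).injective]
    intro h
    have h' : η = 0 := congrArg Subtype.val h
    rw [hηdef] at h'
    exact (φy σ₀).ne_zero h'
  have hσ₀u : σ₀ u = u := by
    rw [hu, map_mul, map_inv₀, map_pow, hσ₀zK, hσ₀yK, mul_pow, mul_inv, ← mul_assoc]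
    congr 1
    rw [mul_comm _ zK, mul_assoc, mul_inv_cancel₀ (pow_ne_zero _ hη0), mul_one]
  have hfix : ∀ σ : KF ≃ₐ[E] KF, σ u = u := by
    intro σ
    obtain ⟨i, hi⟩ := (Submonoid.mem_powers_iff _ _).1 (mem_powers_iff_mem_zpowers.2 (hσ₀ σ))
    rw [← hi]
    exact algEquiv_pow_apply_of_apply_eq σ₀ hσ₀u i
  obtain ⟨e, he⟩ := (IsGalois.mem_range_algebraMap_iff_fixed u).2 hfix
  have h1 : algebraMap E KF e * yK ^ j = zK := by
    rw [he, hu, inv_mul_cancel_right₀ (pow_ne_zero _ hyK0)]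
  have h2 := congrArg Subtype.val h1
  have hcoe : ((algebraMap E KF e : KF) : Ω) = (e : Ω) := rfl
  rw [MulMemClass.coe_mul, SubmonoidClass.coe_pow, hcoe] at h2
  refine ⟨(e : Ω), e.2, j, ?_⟩
  exact h2.symm

/-- The induction step for the tower: `E(y₀, …, y_k) = E(y₀, …, y_{k-1})(y_k)`. [folklore] -/
theorem closure_union_range_le (E : Subfield Ω) {k : ℕ} (y : Fin (k + 1) → Ω) :
    Subfield.closure ((E : Set Ω) ∪ Set.range y) ≤
      Subfield.closure (((Subfield.closure ((E : Set Ω) ∪ Set.range fun i : Fin k => y i.castSucc) :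
        Subfield Ω) : Set Ω) ∪ {y (Fin.last k)}) := by
  refine Subfield.closure_le.2 ?_
  rintro x (hx | ⟨i, rfl⟩)
  · exact Subfield.subset_closure (Or.inl (Subfield.subset_closure (Or.inl hx)))
  · refine Fin.lastCases ?_ (fun j => ?_) i
    · exact Subfield.subset_closure (Or.inr rfl)
    · exact Subfield.subset_closure (Or.inl (Subfield.subset_closure (Or.inr ⟨j, rfl⟩)))

/-- **Radicals of `E` inside `E(y₁, …, y_k)` are monomials** (Lang, *Algebra* VI §8, Thm 8.2;
Bays–Zilber 2011, Lemma 5.1): if `E ⊆ Ω` contains all roots of unity of `Ω` and a primitive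
`N`-th root of unity, `yᵢ ∈ Ωˣ` with `yᵢᴺ ∈ E`, and `z ∈ E(y₁, …, y_k)` with `z^{N'} ∈ E`
(`N' ≥ 1`), then `z = e ∏ yᵢ^{vᵢ}` for some `e ∈ E` and `vᵢ ∈ ℕ`.
[cite: Lang2002, VI §8 Thm 8.2] -/
theorem exists_eq_mul_prod_pow (E : Subfield Ω)
    (hμ : ∀ m : ℕ, 0 < m → ∀ θ : Ω, θ ^ m = 1 → θ ∈ E)
    {N : ℕ} (hN : 0 < N) {ζ : Ω} (hζ : IsPrimitiveRoot ζ N) (hζE : ζ ∈ E) :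
    ∀ (k : ℕ) (y : Fin k → Ω), (∀ i, y i ≠ 0) → (∀ i, y i ^ N ∈ E) →
      ∀ z ∈ Subfield.closure ((E : Set Ω) ∪ Set.range y), ∀ N' : ℕ, 0 < N' → z ^ N' ∈ E →
        ∃ e ∈ E, ∃ v : Fin k → ℕ, z = e * ∏ i, y i ^ v i := by
  intro k
  induction k with
  | zero =>
    intro y _ _ z hz N' _ _
    have hzE : z ∈ E := by
      have : Subfield.closure ((E : Set Ω) ∪ Set.range y) ≤ E := by
        refine Subfield.closure_le.2 ?_
        rintro x (hx | ⟨i, _⟩)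
        · exact hx
        · exact i.elim0
      exact this hz
    exact ⟨z, hzE, Fin.elim0, by simp⟩
  | succ k ih =>
    intro y hy0 hyN z hz N' hN' hzN'
    -- the intermediate base `E_k = E(y₀, …, y_{k-1})`
    set Ek : Subfield Ω := Subfield.closure ((E : Set Ω) ∪ Set.range fun i : Fin k => y i.castSucc)
      with hEk
    have hEEk : E ≤ Ek := fun x hx => Subfield.subset_closure (Or.inl hx)
    have hμk : ∀ m : ℕ, 0 < m → ∀ θ : Ω, θ ^ m = 1 → θ ∈ Ek := fun m hm θ hθ => hEEk (hμ m hm θ hθ)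
    have hz' : z ∈ Subfield.closure ((Ek : Set Ω) ∪ {y (Fin.last k)}) :=
      closure_union_range_le E y hz
    obtain ⟨e₁, he₁, j, hze₁⟩ := exists_eq_mul_pow_of_pow_mem Ek hμk hN hζ (hEEk hζE)
      (hy0 (Fin.last k)) (hEEk (hyN (Fin.last k))) hz' hN' (hEEk hzN')
    -- `e₁ ^ (N' N) ∈ E`
    have hylast0 : y (Fin.last k) ^ j ≠ 0 := pow_ne_zero _ (hy0 _)
    have he₁eq : e₁ = z * (y (Fin.last k) ^ j)⁻¹ := by
      rw [hze₁, mul_inv_cancel_right₀ hylast0]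
    have he₁pow : e₁ ^ (N' * N) ∈ E := by
      have hypow : (y (Fin.last k) ^ j) ^ (N' * N) = (y (Fin.last k) ^ N) ^ (j * N') := by
        rw [← pow_mul, ← pow_mul]; congr 1; ring
      rw [he₁eq, mul_pow, inv_pow, pow_mul, hypow]
      exact E.mul_mem (E.pow_mem hzN' _) (E.inv_mem (E.pow_mem (hyN _) _))
    obtain ⟨e, he, v, hev⟩ := ih (fun i : Fin k => y i.castSucc) (fun i => hy0 _) (fun i => hyN _)
      e₁ he₁ (N' * N) (Nat.mul_pos hN' hN) he₁pow
    refine ⟨e, he, Fin.snoc v j, ?_⟩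
    rw [hze₁, hev, Fin.prod_univ_castSucc]
    simp only [Fin.snoc_castSucc, Fin.snoc_last]
    ring

end KummerRadicals

end Literature.FieldTheory.Kummer
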